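import Summits.ResolutionOfSingularities.ResolutionOfSingularities.Theorems.FrobeniusClosingPatchingRelPerfectDepthPhaseCContactCurePw
import Summits.ResolutionOfSingularities.ResolutionOfSingularities.Theorems.FrobeniusClosingPatchingRelPerfectDepthPhaseCContactCureComp
import Summits.ResolutionOfSingularities.ResolutionOfSingularities.Theorems.FrobeniusClosingPatchingRelPerfectDepthPhaseCContactCureDimTwo
import Summits.ResolutionOfSingularities.ResolutionOfSingularities.Theorems.FrobeniusClosingPatchingRelPerfectDepthPhaseCX3DefsContact
import HarnessLib

/-!
# Crux `PatchingRelPerfect` (stmt-ResolutionOfSingularities-16161), chain W5.2 — F7(β) (β-AX) X3 C-I (M2b) cure §1d: THE CURE GEOMETRY —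
# from the rev-6 contact data along a piece, a blow-up sequence of a patch `W₀ ⊇ P` with regular centres over `P` and regular top (mod F-60)

[OURS · L1 W5.2 · cure plan of record (res-L1-w52-lead-1 g6).]  Replaces the role of NO printed item; NOT a statement of the manuscript under
review (AI-written; AI review weaker than expert review; counted 0).  Def-free.  CONDITIONAL on F-60 (`hF60`).

`exists_cureSeq_of_contactData` — §1 (`exists_realisedCure_of_F60`) with its two hypotheses discharged: `hcomp` by §1b
(`not_subset_boundary_of_mem_irreducibleComponents`) and `hdim` by §1b′ (`topologicalKrullDim_contactSurface_le_two`), on the patch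
`W₀ := U' ⊓ ⋃_{x ∈ P} W_x` (the union of the pointwise patches of the contact block, inside any given open `U' ⊇ P`).  The hypotheses are the
POINTWISE BLOCK and the LEG clause of `HasContactFormOnPw₆` VERBATIM (unbundled, so that §2 — the END extraction — can read the same data);
the conclusion keeps F-60΄s end data relative to the contact set `Sfc`.

## References
* V. Cossart, U. Jannsen, S. Saito, arXiv:0905.2191v2 (2020), Thm. 1.4, Thm. 6.9 (a). [CossartJannsenSaito2020]
* H. Matsumura, *Commutative Ring Theory* (1987), Thm. 13.5, 14.2, 17.4. [Matsumura1987]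
-/

-- `Summit.<Summit>.<Sub>.Theorems` with `Sub = Summit` (single-conjunct summit, D-0017)
set_option linter.dupNamespace false

noncomputable section

namespace Summit.ResolutionOfSingularities.ResolutionOfSingularities.Theorems.X3LemmaM

open CategoryTheory AlgebraicGeometry TopologicalSpace IsLocalRing
open Literature.AlgebraicGeometry.Resolution
open Scheme.IdealSheafData
open Summit.ResolutionOfSingularities.ResolutionOfSingularities.Theorems.DepthMultiHost

universe u

/-- Re-indexing the entries΄ union by the list of entry ideals. [folklore] -/
theorem biUnion_entries_eq {X : Scheme.{u}} (𝓒 : List (List (X.IdealSheafData × ℕ) × X.IdealSheafData)) (V : X.IdealSheafData) :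
    (⋃ c ∈ 𝓒, ⋃ (_ : c.2 ≠ V), (c.2.support : Set X)) = ⋃ Φ ∈ 𝓒.map Prod.snd, ⋃ (_ : Φ ≠ V), (Φ.support : Set X) := by
  ext p
  simp only [Set.mem_iUnion, List.mem_map, exists_prop]
  constructor
  · rintro ⟨c, hc, hcV, hp⟩
    exact ⟨c.2, ⟨c, hc, rfl⟩, hcV, hp⟩
  · rintro ⟨_, ⟨c, hc, rfl⟩, hcV, hp⟩
    exact ⟨c, hc, hcV, hp⟩

open Classical in
/-- [OURS · L1 W5.2 · cure §1d] **THE CURE GEOMETRY** from the rev-6 contact data (pointwise block + LEG of `HasContactFormOnPw₆`, unbundled):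
inside any open `U' ⊇ P` there is an open `W₀ ⊇ P` and a blow-up sequence of `W₀` with regular centres over `P`, regular top, realising an
F-60 sequence for the contact surface `(Sfc ∩ W₀)_red` with boundary the members.  [cite: CossartJannsenSaito2020, Thm. 1.4, Thm. 6.9 (a)]
[cite: Matsumura1987, Thm. 13.5, Thm. 17.4] -/
theorem exists_cureSeq_of_contactData (hF60 : CossartJannsenSaito2020EmbeddedSequenceBoundary.{u})
    {X : Scheme.{u}} [IsNoetherian X] (hX : Scheme.IsRegular X) (hXe : Scheme.IsExcellent X) (hK21 : topologicalKrullDim X ≤ 4)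
    (S : MultiHostState X) (P : Set X) (U : X.Opens) (Sfc : Set X) (hSfc : IsClosed Sfc) (𝓥 : List X.IdealSheafData)
    (𝓒 : List (List (X.IdealSheafData × ℕ) × X.IdealSheafData))
    (hblock : ∀ x ∈ P, ∃ V ∈ 𝓥, V ∉ S.𝓔 ∧ (∀ T ∈ S.𝓔, x ∈ (T.support : Set X) → stalkIdeal V x ≠ stalkIdeal T x) ∧
      ∃ W : X.Opens, x ∈ (W : Set X) ∧ (W : Set X) ⊆ (U : Set X) ∧
      (∃ v : X.presheaf.stalk x, v ∉ (maximalIdeal (X.presheaf.stalk x)) ^ 2 ∧ stalkIdeal V x = Ideal.span {v}) ∧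
      (∀ z ∈ (W : Set X), z ∈ (V.support : Set X) →
        ∃ w : X.presheaf.stalk z, w ∉ (maximalIdeal (X.presheaf.stalk z)) ^ 2 ∧ stalkIdeal V z = Ideal.span {w}) ∧
      (∀ z ∈ (W : Set X), ∀ c ∈ 𝓒, ∃ φ : X.presheaf.stalk z, stalkIdeal c.2 z = Ideal.span {φ}) ∧
      (∀ z ∈ (W : Set X), z ∈ (V.support : Set X) → ∀ c ∈ 𝓒, c.2 ≠ V → z ∈ (c.2.support : Set X) →
        ¬ stalkIdeal c.2 z ≤ stalkIdeal V z) ∧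
      HasSNC ((V :: S.𝓔.filter fun T => decide (x ∈ (T.support : Set X))).map fun F => F.comap W.ι) ∧
      (∀ c ∈ 𝓒, c.2 ≠ V → x ∈ (c.2.support : Set X) →
        ¬ stalkIdeal c.2 x ≤ stalkIdeal V x ∧
        ∀ T ∈ S.𝓔, x ∈ (T.support : Set X) → ¬ stalkIdeal c.2 x ≤ stalkIdeal V x ⊔ stalkIdeal T x) ∧
      stalkIdeal S.residual.K x = stalkIdeal V x ⊔ ⨆ c ∈ 𝓒, stalkIdeal (monomialIdeal c.1) x * stalkIdeal c.2 x ∧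
      Sfc ∩ (W : Set X) = (V.support : Set X) ∩ (⋃ c ∈ 𝓒, ⋃ (_ : c.2 ≠ V), (c.2.support : Set X)) ∩ (W : Set X))
    (hLEG : ∀ y ∈ (U : Set X),
      (y ∈ (vanishingIdeal (⟨Sfc, hSfc⟩ : Closeds X)).subschemeι.base ''
          (Scheme.regularLocus (vanishingIdeal (⟨Sfc, hSfc⟩ : Closeds X)).subscheme)ᶜ ∨
        (y ∈ Sfc ∧ y ∈ ⋃ T ∈ S.𝓔, (T.support : Set X))) → y ∈ P)
    (U' : X.Opens) (hPU' : P ⊆ (U' : Set X)) :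
    ∃ W₀ : X.Opens, P ⊆ (W₀ : Set X) ∧ (W₀ : Set X) ⊆ (U' : Set X) ∧ (W₀ : Set X) ⊆ (U : Set X) ∧
      ∃ s : CentreSeq (W₀ : Scheme.{u}), s.AllRegular ∧ s.CentresOver (W₀.ι.base ⁻¹' P) ∧ Scheme.IsRegular s.top ∧
      ∃ (Z₁ : Scheme.{u}) (π : Z₁ ⟶ (W₀ : Scheme.{u})) (X₁ B₁ : Set Z₁) (e : s.top ≅ Z₁),
        IsBPermissibleSequenceB (W₀.ι.base ⁻¹' Sfc) (W₀.ι.base ⁻¹' ⋃ D ∈ S.𝓔, (D.support : Set X)) π X₁ B₁ ∧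
        e.hom ≫ π = s.comp ∧ Scheme.IsRegular Z₁ ∧
        Scheme.IsRegular (vanishingIdeal (⟨closure X₁, isClosed_closure⟩ : Closeds Z₁)).subscheme ∧
        IsStrictNormalCrossingsDivisor Z₁ B₁ ∧
        π.base ⁻¹' (W₀.ι.base ⁻¹' Sfc ∪ W₀.ι.base ⁻¹' ⋃ D ∈ S.𝓔, (D.support : Set X)) = X₁ ∪ B₁ ∧ IsTransversalWith Z₁ X₁ B₁ := by
  -- choose the pointwise patches and form `W₀`
  choose Vx hVx𝓥 hVxE hVxT Wx hxWx hWxU hvx hordx hprinx hNF0x hsncx hNF1x hstalkx hsetx using hblock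
  let W₀ : X.Opens := U' ⊓ ⨆ x : {x // x ∈ P}, Wx x.1 x.2
  have hW₀P : P ⊆ (W₀ : Set X) := by
    intro x hx
    refine ⟨hPU' hx, ?_⟩
    simp only [Opens.coe_iSup, Set.mem_iUnion]
    exact ⟨⟨x, hx⟩, hxWx x hx⟩
  have hW₀U' : (W₀ : Set X) ⊆ (U' : Set X) := fun p hp => hp.1
  have hW₀cov : ∀ p ∈ (W₀ : Set X), ∃ x, ∃ hx : x ∈ P, p ∈ (Wx x hx : Set X) := by
    rintro p ⟨-, hp⟩
    simp only [Opens.coe_iSup, Set.mem_iUnion] at hp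
    obtain ⟨⟨x, hx⟩, hpx⟩ := hp
    exact ⟨x, hx, hpx⟩
  have hW₀U : (W₀ : Set X) ⊆ (U : Set X) := by
    intro p hp
    obtain ⟨x, hx, hpx⟩ := hW₀cov p hp
    exact hWxU x hx hpx
  refine ⟨W₀, hW₀P, hW₀U', hW₀U, ?_⟩
  -- the two hypotheses of §1
  have hdim := topologicalKrullDim_contactSurface_le_two hX hK21 Sfc hSfc W₀ (fun z hzS hzW₀ => by
    obtain ⟨x, hx, hzx⟩ := hW₀cov z hzW₀
    have hzset : z ∈ Sfc ∩ (Wx x hx : Set X) := ⟨hzS, hzx⟩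
    rw [hsetx x hx] at hzset
    obtain ⟨⟨hzV, -⟩, -⟩ := hzset
    refine ⟨Vx x hx, 𝓒.map Prod.snd, Wx x hx, hzx, hzV, hordx x hx z hzx hzV, ?_, ?_, ?_⟩
    · intro Φ hΦ
      obtain ⟨c, hc, rfl⟩ := List.mem_map.mp hΦ
      exact hprinx x hx z hzx c hc
    · intro Φ hΦ hΦV hzΦ
      obtain ⟨c, hc, rfl⟩ := List.mem_map.mp hΦ
      exact hNF0x x hx z hzx hzV c hc hΦV hzΦ
    · rw [hsetx x hx, biUnion_entries_eq]
      exact Set.inter_subset_left)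
  have hcomp := not_subset_boundary_of_mem_irreducibleComponents S.𝓔 Sfc hSfc P W₀
    (fun y hyW hyS hyB => hLEG y (hW₀U hyW) (Or.inr ⟨hyS, hyB⟩)) (fun x hx _ => by
      obtain ⟨v, -, hv⟩ := hvx x hx
      refine ⟨Vx x hx, Wx x hx, 𝓒.map Prod.snd, hxWx x hx, hVxT x hx, ⟨v, hv⟩, hsncx x hx, ?_, ?_, ?_⟩
      · intro Φ hΦ
        obtain ⟨c, hc, rfl⟩ := List.mem_map.mp hΦ
        exact hprinx x hx x (hxWx x hx) c hc
      · intro Φ hΦ hΦV hxΦ T hT hxT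
        obtain ⟨c, hc, rfl⟩ := List.mem_map.mp hΦ
        exact (hNF1x x hx c hc hΦV hxΦ).2 T hT hxT
      · rw [hsetx x hx, biUnion_entries_eq])
  exact exists_realisedCure_of_F60 hF60 hX hXe S.𝓔 S.snc Sfc hSfc P W₀
    (fun y hyW h => hLEG y (hW₀U hyW) h) hdim hcomp

end Summit.ResolutionOfSingularities.ResolutionOfSingularities.Theorems.X3LemmaM

end
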